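import Mathlib.Algebra.Algebra.Basic
import Mathlib.Algebra.Algebra.Tower
import Mathlib.RingTheory.Ideal.Pointwise
import Mathlib.Algebra.Module.Submodule.Pointwise
import Mathlib.LinearAlgebra.Quotient.Basic
import Mathlib.LinearAlgebra.Isomorphisms
import Mathlib.SetTheory.Cardinal.Finite
import HarnessLib

/-!
# Stable lattices with irreducible socle are unique up to homothety (Emerton–Gee–Savitt, Lemma 4.1.1)

Topic `RepresentationTheory`; namespace `Literature.RepresentationTheory`.  THEOREMS ONLY (no definition, no
named fact, no `sorry`, no instance, no notation).

M. Emerton, T. Gee, D. Savitt, *Lattices in the cohomology of Shimura curves*, Invent. Math. 200 (2015),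
Lemma 4.1.1 (= Lemma 14 of arXiv:1305.1594, "well-known, but for lack of a convenient reference we give the
details here"): let `σ` be an irreducible `E`-representation of a group `Γ` which is *residually multiplicity
free* (every Jordan–Hölder factor of the reduction of a stable lattice occurs once); then for each
Jordan–Hölder factor `σ̄ᵢ` there is, UP TO HOMOTHETY, a unique `Γ`-stable `𝒪`-lattice whose reduction has
socle exactly `σ̄ᵢ`.  The printed uniqueness proof: "suppose that `L`, `L'` are two `Γ`-stable lattices in `σ`
with socle `σ̄ᵢ`.  After scaling we may suppose that `L' ⊆ L` but `L' ⊄ ϖL`.  Consider the induced map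
`L'/ϖL' → L/ϖL`; it is non-zero by construction.  If this is not an isomorphism then (for length reasons) it
is not surjective, and thus has non-trivial kernel, which necessarily contains the socle `σ̄ᵢ` of `L'/ϖL'`.
Similarly its image, being non-zero, contains the socle of `L/ϖL`.  Thus `σ̄ᵢ` occurs at least twice in
`L'/ϖL'`, contradicting" multiplicity-freeness; and an isomorphism `L'/ϖL' ≅ L/ϖL` forces `L' = L`
(Nakayama).

## What is formalised (general commutative-algebra form)

`R` a commutative ring, `ϖ : R`, `A` an `R`-algebra (e.g. `A = R[Γ]`), `V` an `A`-module with compatible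
`R`-action (`IsScalarTower R A V`), `L' ≤ L` two `A`-submodules of `V` ("lattices"; no field of fractions is
needed), reductions `L/ϖL := ↥L ⧸ (ϖ • L).comap L.subtype` as `A`-modules.  The hypotheses replacing
"lattice in an irreducible representation over a discrete valuation ring" are exactly what the printed proof
uses: commensurability `ϖⁿ • L ≤ L'` (so that "`L = L' + ϖL` ⟹ `L = L'`" needs no locality of `R`), and
"length reasons" in the form `L/ϖL` finite with `Nat.card (L/ϖL) ≤ Nat.card (L'/ϖL')` (equal, for free
`ℤₚ`-lattices of the same rank).

* (private helpers `pointwise_smul_le_self`, `le_sup_pow_smul_of_le_sup_smul`: `r • L ≤ L`, and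
  `L ≤ L' ⊔ ϖ • L` ⟹ `L ≤ L' ⊔ ϖⁿ • L` — the iteration step of Nakayama's lemma in its `ϖ`-adic form);
* `eq_of_le_of_inf_smul_le` — CORE: `L' ≤ L`, `ϖⁿ • L ≤ L'`, the reduction map `L'/ϖL' → L/ϖL` injective
  (stated lattice-theoretically as `L' ⊓ ϖ • L ≤ ϖ • L'`) and the counting hypothesis ⟹ `L' = L`;
* `eq_of_le_of_not_le_smul_of_socle` — **EGS Lemma 4.1.1, uniqueness half**: `L' ≤ L`, `L' ⊄ ϖ • L`
  (the normalised position "after scaling"), commensurability and counting as above, an `A`-module `S`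
  (the Jordan–Hölder factor `σ̄ᵢ`) such that every non-zero `A`-submodule of `L'/ϖL'` and of `L/ϖL`
  contains an injective image of `S` ("socle is `S`-isotypic / irreducible `≅ S`") and `S` does NOT embed
  simultaneously into a submodule `N ≤ L'/ϖL'` and into the quotient `(L'/ϖL')/N` ("`σ̄ᵢ` occurs once")
  ⟹ `L' = L`.

* `exists_smul_eq_smul_of_socle` — HOMOTHETY FORM: for commensurable `L`, `L'` in arbitrary position
  (`ϖ` injective on `V`, `L` separated relative to `L'`) the same hypotheses give `ϖᵐ • L' = ϖᵏ • L`.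
The existence half of the lemma and the cosocle variant (by passing to contragredients) are not formalised
here.  Intended use: `R = ℤ_[p]` (or `ℤ`), `ϖ = p`, `A = ℤ_[p][GL₂(𝔽_p)]`, `σ` a tame principal-series type.

## References
* [EmertonGeeSavitt2015] M. Emerton, T. Gee, D. Savitt, Invent. Math. 200 (2015) 1–96, §4.1, Lemma 4.1.1.
-/

namespace Literature.RepresentationTheory

open Pointwise Function

universe u v w x

variable {R : Type u} [CommRing R] {A : Type v} [Ring A] [Algebra R A]
variable {V : Type w} [AddCommGroup V] [Module A V] [Module R V] [IsScalarTower R A V]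

/-- For an `A`-submodule `L` of `V` and a scalar `r` of the commutative coefficient ring `R` (acting through
the centre of `A`), `r • L ≤ L`. [folklore] -/
private theorem pointwise_smul_le_self (r : R) (L : Submodule A V) : r • L ≤ L := by
  rintro x hx
  rw [← SetLike.mem_coe, Submodule.coe_pointwise_smul, Set.mem_smul_set] at hx
  obtain ⟨y, hy, rfl⟩ := hx
  rw [← algebraMap_smul A r y]
  exact L.smul_mem _ hy

/-- Iteration step of the `ϖ`-adic Nakayama argument: if `L ≤ L' ⊔ ϖ • L` with `L' ≤ L`... (only
`ϖ • L' ≤ L'` is used) then `L ≤ L' ⊔ ϖⁿ • L` for every `n`. [folklore] -/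
private theorem le_sup_pow_smul_of_le_sup_smul (ϖ : R) {L L' : Submodule A V} (h : L ≤ L' ⊔ ϖ • L) (n : ℕ) :
    L ≤ L' ⊔ ϖ ^ n • L := by
  induction n with
  | zero => rw [pow_zero, one_smul]; exact le_sup_right
  | succ n ih =>
    intro x hx
    obtain ⟨a, ha, b, hb, rfl⟩ := Submodule.mem_sup.mp (ih hx)
    rw [← SetLike.mem_coe, Submodule.coe_pointwise_smul, Set.mem_smul_set] at hb
    obtain ⟨y, hy, rfl⟩ := hb
    obtain ⟨c, hc, d, hd, rfl⟩ := Submodule.mem_sup.mp (h hy)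
    rw [← SetLike.mem_coe, Submodule.coe_pointwise_smul, Set.mem_smul_set] at hd
    obtain ⟨z, hz, rfl⟩ := hd
    rw [smul_add, smul_smul, ← pow_succ]
    refine Submodule.add_mem _ (Submodule.mem_sup_left ha) (Submodule.add_mem _ ?_ ?_)
    · exact Submodule.mem_sup_left (pointwise_smul_le_self (ϖ ^ n) L' (Submodule.smul_mem_pointwise_smul c _ L' hc))
    · exact Submodule.mem_sup_right (Submodule.smul_mem_pointwise_smul z _ L hz)

/-- CORE of EGS Lemma 4.1.1 (after the socle argument has made the reduction map injective): let `L' ≤ L` be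
`A`-submodules with `ϖⁿ • L ≤ L'` for some `n`, suppose the reduction map `L'/ϖL' → L/ϖL` is injective — i.e.
`L' ⊓ ϖ • L ≤ ϖ • L'` — and that `L/ϖL` is finite with `Nat.card (L/ϖL) ≤ Nat.card (L'/ϖL')` ("for length
reasons").  Then `L' = L`.  Proof: the injective reduction map between finite sets of those cardinalities is
bijective, so `L ≤ L' ⊔ ϖ • L`, whence `L ≤ L' ⊔ ϖⁿ • L = L'`.
[cite: EmertonGeeSavitt2015, Lemma 4.1.1 (proof, second half)] -/
theorem eq_of_le_of_inf_smul_le (ϖ : R) {L L' : Submodule A V} (hle : L' ≤ L)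
    (htor : ∃ n : ℕ, ϖ ^ n • L ≤ L') (hker : L' ⊓ ϖ • L ≤ ϖ • L')
    [Finite (↥L ⧸ (ϖ • L).comap L.subtype)]
    (hcard : Nat.card (↥L ⧸ (ϖ • L).comap L.subtype) ≤ Nat.card (↥L' ⧸ (ϖ • L').comap L'.subtype)) :
    L' = L := by
  -- the reduction map
  have hcomp : (ϖ • L').comap L'.subtype ≤ ((ϖ • L).comap L.subtype).comap (Submodule.inclusion hle) := by
    intro y hy
    simp only [Submodule.mem_comap, Submodule.coe_subtype, Submodule.coe_inclusion] at hy ⊢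
    rw [← SetLike.mem_coe, Submodule.coe_pointwise_smul, Set.mem_smul_set] at hy
    rw [← SetLike.mem_coe, Submodule.coe_pointwise_smul, Set.mem_smul_set]
    obtain ⟨z, hz, hzy⟩ := hy
    exact ⟨z, hle hz, hzy⟩
  set r : (↥L' ⧸ (ϖ • L').comap L'.subtype) →ₗ[A] (↥L ⧸ (ϖ • L).comap L.subtype) :=
    Submodule.mapQ _ _ (Submodule.inclusion hle) hcomp with hr
  -- it is injective
  have hinj : Injective r := by
    rw [← LinearMap.ker_eq_bot, eq_bot_iff]
    intro q hq
    obtain ⟨y, rfl⟩ := Submodule.Quotient.mk_surjective _ q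
    rw [LinearMap.mem_ker, hr, Submodule.mapQ_apply, Submodule.Quotient.mk_eq_zero, Submodule.mem_comap,
      Submodule.coe_subtype, Submodule.coe_inclusion] at hq
    rw [Submodule.mem_bot, Submodule.Quotient.mk_eq_zero, Submodule.mem_comap, Submodule.coe_subtype]
    exact hker ⟨y.2, hq⟩
  -- hence bijective, for cardinality reasons
  have hbij : Bijective r := hinj.bijective_of_nat_card_le hcard
  -- so `L ≤ L' ⊔ ϖ • L`
  have hsup : L ≤ L' ⊔ ϖ • L := by
    intro x hx
    obtain ⟨q, hq⟩ := hbij.2 (Submodule.Quotient.mk ⟨x, hx⟩)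
    obtain ⟨y, rfl⟩ := Submodule.Quotient.mk_surjective _ q
    rw [hr, Submodule.mapQ_apply, Submodule.Quotient.eq, Submodule.mem_comap, Submodule.coe_subtype] at hq
    have hmem : ((Submodule.inclusion hle y : ↥L) : V) - x ∈ ϖ • L := by
      simpa using hq
    have : x = (y : V) - (((Submodule.inclusion hle y : ↥L) : V) - x) := by
      simp [Submodule.coe_inclusion]
    rw [this]
    exact Submodule.sub_mem _ (Submodule.mem_sup_left y.2) (Submodule.mem_sup_right hmem)
  -- Nakayama, `ϖ`-adic form
  obtain ⟨n, hn⟩ := htor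
  refine le_antisymm hle ?_
  calc L ≤ L' ⊔ ϖ ^ n • L := le_sup_pow_smul_of_le_sup_smul ϖ hsup n
    _ ≤ L' := sup_le le_rfl hn

/-- **Emerton–Gee–Savitt 2015, Lemma 4.1.1 (uniqueness of stable lattices with irreducible socle).**
Let `L' ≤ L` be `A`-submodules of `V` in normalised position `L' ⊄ ϖ • L` ("after scaling"), commensurable
(`ϖⁿ • L ≤ L'`), with `L/ϖL` finite and `Nat.card (L/ϖL) ≤ Nat.card (L'/ϖL')` ("length reasons"), and let
`S` be an `A`-module (the Jordan–Hölder factor `σ̄ᵢ`) such that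
* every non-zero `A`-submodule of `L'/ϖL'` and every non-zero `A`-submodule of `L/ϖL` receives an injective
  `A`-linear map from `S` (both reductions have socle "`σ̄ᵢ`"), and
* `S` does not embed `A`-linearly into a submodule `N` of `L'/ϖL'` and into `(L'/ϖL')/N` at the same time
  ("`σ̄ᵢ` occurs with multiplicity one in `L'/ϖL'`").
Then `L' = L`.  Printed proof verbatim: the reduction map `L'/ϖL' → L/ϖL` is non-zero; were its kernel
non-zero it would contain a copy of `S`, and its non-zero image — isomorphic to `(L'/ϖL')/ker` — another,
so `S` would occur twice; hence the map is injective and `eq_of_le_of_inf_smul_le` applies.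
[cite: EmertonGeeSavitt2015, Lemma 4.1.1] -/
theorem eq_of_le_of_not_le_smul_of_socle (ϖ : R) {L L' : Submodule A V} (hle : L' ≤ L)
    (hnot : ¬ L' ≤ ϖ • L) (htor : ∃ n : ℕ, ϖ ^ n • L ≤ L')
    [Finite (↥L ⧸ (ϖ • L).comap L.subtype)]
    (hcard : Nat.card (↥L ⧸ (ϖ • L).comap L.subtype) ≤ Nat.card (↥L' ⧸ (ϖ • L').comap L'.subtype))
    {S : Type x} [AddCommGroup S] [Module A S]
    (hsocL' : ∀ N : Submodule A (↥L' ⧸ (ϖ • L').comap L'.subtype), N ≠ ⊥ →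
      ∃ f : S →ₗ[A] N, Injective f)
    (hsocL : ∀ N : Submodule A (↥L ⧸ (ϖ • L).comap L.subtype), N ≠ ⊥ →
      ∃ f : S →ₗ[A] N, Injective f)
    (hmult : ∀ N : Submodule A (↥L' ⧸ (ϖ • L').comap L'.subtype),
      (∃ f : S →ₗ[A] N, Injective f) →
      (∃ g : S →ₗ[A] ((↥L' ⧸ (ϖ • L').comap L'.subtype) ⧸ N), Injective g) → False) :
    L' = L := by
  -- the reduction map
  have hcomp : (ϖ • L').comap L'.subtype ≤ ((ϖ • L).comap L.subtype).comap (Submodule.inclusion hle) := by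
    intro y hy
    simp only [Submodule.mem_comap, Submodule.coe_subtype, Submodule.coe_inclusion] at hy ⊢
    rw [← SetLike.mem_coe, Submodule.coe_pointwise_smul, Set.mem_smul_set] at hy
    rw [← SetLike.mem_coe, Submodule.coe_pointwise_smul, Set.mem_smul_set]
    obtain ⟨z, hz, hzy⟩ := hy
    exact ⟨z, hle hz, hzy⟩
  set r : (↥L' ⧸ (ϖ • L').comap L'.subtype) →ₗ[A] (↥L ⧸ (ϖ • L).comap L.subtype) :=
    Submodule.mapQ _ _ (Submodule.inclusion hle) hcomp with hr
  -- it is non-zero: `L' ⊄ ϖ • L`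
  have hne : r ≠ 0 := by
    intro h0
    apply hnot
    intro y hy
    have := LinearMap.congr_fun h0 (Submodule.Quotient.mk ⟨y, hy⟩)
    rw [LinearMap.zero_apply, hr, Submodule.mapQ_apply, Submodule.Quotient.mk_eq_zero, Submodule.mem_comap,
      Submodule.coe_subtype, Submodule.coe_inclusion] at this
    exact this
  -- its kernel is trivial, by the socle / multiplicity-one argument
  have hker : LinearMap.ker r = ⊥ := by
    by_contra hK
    -- the kernel contains a copy of `S`
    obtain ⟨f, hf⟩ := hsocL' (LinearMap.ker r) hK
    -- the image is non-zero, hence contains a copy of `S`, and is isomorphic to the quotient by the kernel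
    have hR : LinearMap.range r ≠ ⊥ := by
      intro h
      exact hne (LinearMap.range_eq_bot.mp h)
    obtain ⟨g, hg⟩ := hsocL (LinearMap.range r) hR
    refine hmult (LinearMap.ker r) ⟨f, hf⟩ ⟨(r.quotKerEquivRange.symm : _ →ₗ[A] _) ∘ₗ g, ?_⟩
    exact r.quotKerEquivRange.symm.injective.comp hg
  -- lattice-theoretic form of injectivity
  have hinf : L' ⊓ ϖ • L ≤ ϖ • L' := by
    rintro y ⟨hyL', hyL⟩
    have hk : Submodule.Quotient.mk (p := (ϖ • L').comap L'.subtype) (⟨y, hyL'⟩ : ↥L') ∈ LinearMap.ker r := by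
      rw [LinearMap.mem_ker, hr, Submodule.mapQ_apply, Submodule.Quotient.mk_eq_zero, Submodule.mem_comap,
        Submodule.coe_subtype, Submodule.coe_inclusion]
      exact hyL
    rw [hker, Submodule.mem_bot, Submodule.Quotient.mk_eq_zero, Submodule.mem_comap,
      Submodule.coe_subtype] at hk
    exact hk
  exact eq_of_le_of_inf_smul_le ϖ hle htor hinf hcard

section Homothety

/-- Pointwise scalar multiplication of submodules is monotone. [folklore] -/
private theorem pointwise_smul_mono (r : R) {L L' : Submodule A V} (h : L ≤ L') : r • L ≤ r • L' := by
  intro x hx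
  rw [← SetLike.mem_coe, Submodule.coe_pointwise_smul, Set.mem_smul_set] at hx
  rw [← SetLike.mem_coe, Submodule.coe_pointwise_smul, Set.mem_smul_set]
  obtain ⟨y, hy, rfl⟩ := hx
  exact ⟨y, h hy, rfl⟩

/-- If `ϖ` acts injectively on `V` then so does `ϖᵏ`. [folklore] -/
private theorem pow_smul_injective (ϖ : R) (hϖ : ∀ v : V, ϖ • v = 0 → v = 0) (k : ℕ) (v : V)
    (hv : ϖ ^ k • v = 0) : v = 0 := by
  induction k generalizing v with
  | zero => simpa using hv
  | succ k ih => rw [pow_succ, mul_smul] at hv; exact hϖ _ (ih _ hv)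

/-- The reduction `L/ϖL` is unchanged, up to an `A`-linear isomorphism, by rescaling `L ↦ ϖᵏ • L` when `ϖ`
acts injectively on `V` (multiplication by `ϖᵏ` induces it). [folklore] -/
private theorem nonempty_reductionEquiv (ϖ : R) (hϖ : ∀ v : V, ϖ • v = 0 → v = 0) (L : Submodule A V)
    (k : ℕ) :
    Nonempty ((↥L ⧸ (ϖ • L).comap L.subtype) ≃ₗ[A]
      (↥(ϖ ^ k • L) ⧸ (ϖ • (ϖ ^ k • L)).comap (ϖ ^ k • L).subtype)) := by
  let f : ↥L →ₗ[A] ↥(ϖ ^ k • L) :=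
    { toFun := fun x => ⟨ϖ ^ k • (x : V), Submodule.smul_mem_pointwise_smul _ _ _ x.2⟩
      map_add' := fun x y => Subtype.ext (by
        show ϖ ^ k • ((x + y : ↥L) : V) = ϖ ^ k • (x : V) + ϖ ^ k • (y : V)
        rw [Submodule.coe_add, smul_add])
      map_smul' := fun a x => Subtype.ext (by
        show ϖ ^ k • ((a • x : ↥L) : V) = a • (ϖ ^ k • (x : V))
        rw [Submodule.coe_smul, smul_comm]) }
  have hf : ∀ x : ↥L, ((f x : ↥(ϖ ^ k • L)) : V) = ϖ ^ k • (x : V) := fun x => rfl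
  have hinj : Injective f := by
    intro x y hxy
    have h := congrArg (fun z : ↥(ϖ ^ k • L) => (z : V)) hxy
    simp only [hf] at h
    exact Subtype.ext (sub_eq_zero.mp (pow_smul_injective ϖ hϖ k _ (by rw [smul_sub, h, sub_self])))
  have hsurj : Surjective f := by
    rintro ⟨z, hz⟩
    rw [← SetLike.mem_coe, Submodule.coe_pointwise_smul, Set.mem_smul_set] at hz
    obtain ⟨y, hy, rfl⟩ := hz
    exact ⟨⟨y, hy⟩, by ext; simp [hf]⟩
  let e : ↥L ≃ₗ[A] ↥(ϖ ^ k • L) := LinearEquiv.ofBijective f ⟨hinj, hsurj⟩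
  have he : ∀ x : ↥L, ((e x : ↥(ϖ ^ k • L)) : V) = ϖ ^ k • (x : V) := fun x => rfl
  refine ⟨Submodule.Quotient.equiv _ _ e ?_⟩
  ext z
  simp only [Submodule.mem_map, Submodule.mem_comap, Submodule.coe_subtype]
  constructor
  · rintro ⟨x, hx, rfl⟩
    rw [LinearEquiv.coe_coe, he]
    rw [← SetLike.mem_coe, Submodule.coe_pointwise_smul, Set.mem_smul_set] at hx
    obtain ⟨y, hy, hyx⟩ := hx
    rw [← hyx, smul_comm (ϖ ^ k) ϖ y]
    exact Submodule.smul_mem_pointwise_smul (ϖ ^ k • y) ϖ (ϖ ^ k • L)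
      (Submodule.smul_mem_pointwise_smul y (ϖ ^ k) L hy)
  · intro hz
    rw [← SetLike.mem_coe, Submodule.coe_pointwise_smul, Set.mem_smul_set] at hz
    obtain ⟨w, hw, hwz⟩ := hz
    rw [Submodule.coe_pointwise_smul, Set.mem_smul_set] at hw
    obtain ⟨y, hy, rfl⟩ := hw
    refine ⟨e.symm z, ?_, by rw [LinearEquiv.coe_coe]; exact e.apply_symm_apply z⟩
    have hval : ((e (e.symm z) : ↥(ϖ ^ k • L)) : V) = (z : V) := by rw [e.apply_symm_apply]
    rw [he] at hval
    have hsub : ϖ ^ k • (((e.symm z : ↥L) : V) - ϖ • y) = 0 := by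
      rw [smul_sub, hval, smul_comm, hwz, sub_self]
    have : ((e.symm z : ↥L) : V) = ϖ • y := sub_eq_zero.mp (pow_smul_injective ϖ hϖ k _ hsub)
    rw [this]
    exact Submodule.smul_mem_pointwise_smul _ _ _ hy

variable {S : Type x} [AddCommGroup S] [Module A S]

/-- Transport of "every non-zero submodule receives an injection from `S`" along an isomorphism. [folklore] -/
private theorem socle_transport {M₁ : Type*} {M₂ : Type*} [AddCommGroup M₁] [Module A M₁]
    [AddCommGroup M₂] [Module A M₂] (E : M₁ ≃ₗ[A] M₂)
    (h : ∀ N : Submodule A M₁, N ≠ ⊥ → ∃ f : S →ₗ[A] N, Injective f)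
    (N : Submodule A M₂) (hN : N ≠ ⊥) : ∃ f : S →ₗ[A] N, Injective f := by
  have hmap : (N.comap (E : M₁ →ₗ[A] M₂)).map (E : M₁ →ₗ[A] M₂) = N :=
    Submodule.map_comap_eq_of_surjective E.surjective N
  have hN' : N.comap (E : M₁ →ₗ[A] M₂) ≠ ⊥ := by
    intro hb
    apply hN
    rw [← hmap, hb, Submodule.map_bot]
  obtain ⟨f, hf⟩ := h _ hN'
  let e₁ : ↥(N.comap (E : M₁ →ₗ[A] M₂)) ≃ₗ[A] ↥((N.comap (E : M₁ →ₗ[A] M₂)).map (E : M₁ →ₗ[A] M₂)) :=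
    E.submoduleMap _
  let e₂ : ↥((N.comap (E : M₁ →ₗ[A] M₂)).map (E : M₁ →ₗ[A] M₂)) ≃ₗ[A] ↥N := LinearEquiv.ofEq _ _ hmap
  refine ⟨(e₂.toLinearMap ∘ₗ e₁.toLinearMap) ∘ₗ f, ?_⟩
  exact (e₂.injective.comp e₁.injective).comp hf

/-- Transport of "`S` does not occur in a submodule and in its quotient simultaneously". [folklore] -/
private theorem mult_transport {M₁ : Type*} {M₂ : Type*} [AddCommGroup M₁] [Module A M₁]
    [AddCommGroup M₂] [Module A M₂] (E : M₁ ≃ₗ[A] M₂)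
    (h : ∀ N : Submodule A M₁, (∃ f : S →ₗ[A] N, Injective f) →
      (∃ g : S →ₗ[A] (M₁ ⧸ N), Injective g) → False)
    (N : Submodule A M₂) (hf : ∃ f : S →ₗ[A] N, Injective f)
    (hg : ∃ g : S →ₗ[A] (M₂ ⧸ N), Injective g) : False := by
  obtain ⟨f, hf⟩ := hf
  obtain ⟨g, hg⟩ := hg
  have hmap : (N.comap (E : M₁ →ₗ[A] M₂)).map (E : M₁ →ₗ[A] M₂) = N :=
    Submodule.map_comap_eq_of_surjective E.surjective N
  have hmap' : N.map (E.symm : M₂ →ₗ[A] M₁) = N.comap (E : M₁ →ₗ[A] M₂) := by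
    rw [Submodule.map_equiv_eq_comap_symm, LinearEquiv.symm_symm]
  let e₁ : ↥N ≃ₗ[A] ↥(N.map (E.symm : M₂ →ₗ[A] M₁)) := E.symm.submoduleMap N
  let e₂ : ↥(N.map (E.symm : M₂ →ₗ[A] M₁)) ≃ₗ[A] ↥(N.comap (E : M₁ →ₗ[A] M₂)) :=
    LinearEquiv.ofEq _ _ hmap'
  let e₃ : (M₂ ⧸ N) ≃ₗ[A] (M₁ ⧸ N.comap (E : M₁ →ₗ[A] M₂)) := (Submodule.Quotient.equiv _ _ E hmap).symm
  refine h (N.comap (E : M₁ →ₗ[A] M₂)) ⟨(e₂.toLinearMap ∘ₗ e₁.toLinearMap) ∘ₗ f, ?_⟩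
    ⟨e₃.toLinearMap ∘ₗ g, ?_⟩
  · exact (e₂.injective.comp e₁.injective).comp hf
  · exact e₃.injective.comp hg

/-- **Emerton–Gee–Savitt 2015, Lemma 4.1.1 — homothety form.**  Let `ϖ` act injectively on `V`; let `L`,
`L'` be commensurable `A`-submodules (`ϖᵐ • L' ≤ L` and `ϖⁿ • L ≤ L'` for some `n`) with `L' ≠ ⊥`, `L`
separated relative to `L'` (an element of `L'` lying in every `ϖʲ • L` is `0`), `L/ϖL` finite with
`Nat.card (L/ϖL) ≤ Nat.card (L'/ϖL')`; and let `S` be an `A`-module such that every non-zero `A`-submodule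
of `L/ϖL` and of `L'/ϖL'` receives an injective `A`-linear map from `S` (both socles are `S`) and `S` does not
embed into a submodule `N ≤ L'/ϖL'` and into `(L'/ϖL')/N` at the same time (`S` occurs once).  Then `L`
and `L'` are HOMOTHETIC: `ϖᵐ • L' = ϖᵏ • L` for some `k`.  Proof = the printed reduction "after scaling we
may suppose `L' ⊆ L`, `L' ⊄ ϖL`": take `k` maximal with `ϖᵐ • L' ≤ ϖᵏ • L` (it exists by separatedness),
transport all hypotheses along `L/ϖL ≃ ϖᵏL/ϖᵏ⁺¹L`, `L'/ϖL' ≃ ϖᵐL'/ϖᵐ⁺¹L'` (multiplication by `ϖᵏ`,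
`ϖᵐ`), and apply `eq_of_le_of_not_le_smul_of_socle`. [cite: EmertonGeeSavitt2015, Lemma 4.1.1] -/
theorem exists_smul_eq_smul_of_socle (ϖ : R) (hϖ : ∀ v : V, ϖ • v = 0 → v = 0) {L L' : Submodule A V}
    {m : ℕ} (hm : ϖ ^ m • L' ≤ L) (htor : ∃ n : ℕ, ϖ ^ n • L ≤ L') (hne : L' ≠ ⊥)
    (hsep : ∀ x ∈ L', (∀ j : ℕ, x ∈ ϖ ^ j • L) → x = 0)
    [Finite (↥L ⧸ (ϖ • L).comap L.subtype)]
    (hcard : Nat.card (↥L ⧸ (ϖ • L).comap L.subtype) ≤ Nat.card (↥L' ⧸ (ϖ • L').comap L'.subtype))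
    (hsocL' : ∀ N : Submodule A (↥L' ⧸ (ϖ • L').comap L'.subtype), N ≠ ⊥ →
      ∃ f : S →ₗ[A] N, Injective f)
    (hsocL : ∀ N : Submodule A (↥L ⧸ (ϖ • L).comap L.subtype), N ≠ ⊥ →
      ∃ f : S →ₗ[A] N, Injective f)
    (hmult : ∀ N : Submodule A (↥L' ⧸ (ϖ • L').comap L'.subtype),
      (∃ f : S →ₗ[A] N, Injective f) →
      (∃ g : S →ₗ[A] ((↥L' ⧸ (ϖ • L').comap L'.subtype) ⧸ N), Injective g) → False) :
    ∃ k : ℕ, ϖ ^ m • L' = ϖ ^ k • L := by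
  classical
  -- (1) some `ϖᵏ • L` fails to contain `ϖᵐ • L'` (separatedness), so there is a last `k` that does
  have hex : ∃ k : ℕ, ¬ ϖ ^ m • L' ≤ ϖ ^ k • L := by
    by_contra hall
    simp only [not_exists, not_not] at hall
    apply hne
    rw [eq_bot_iff]
    intro x hx
    have hmx : ϖ ^ m • x ∈ ϖ ^ m • L' := Submodule.smul_mem_pointwise_smul _ _ _ hx
    have h0 : ϖ ^ m • x = 0 :=
      hsep _ (pointwise_smul_le_self (ϖ ^ m) L' hmx) (fun j => hall j hmx)
    rw [Submodule.mem_bot]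
    exact pow_smul_injective ϖ hϖ m x h0
  set k₁ := Nat.find hex with hk₁def
  have hk₁ : ¬ ϖ ^ m • L' ≤ ϖ ^ k₁ • L := Nat.find_spec hex
  have hk₁ne : k₁ ≠ 0 := by
    intro h0
    apply hk₁
    rw [h0, pow_zero, one_smul]
    exact hm
  obtain ⟨k, hk⟩ : ∃ k, k₁ = k + 1 := Nat.exists_eq_succ_of_ne_zero hk₁ne
  have hle : ϖ ^ m • L' ≤ ϖ ^ k • L := by
    by_contra h
    exact Nat.find_min hex (show k < k₁ by omega) h
  have hnot : ¬ ϖ ^ m • L' ≤ ϖ • (ϖ ^ k • L) := by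
    rw [smul_smul, ← pow_succ', ← hk]
    exact hk₁
  refine ⟨k, ?_⟩
  -- (2) transport the hypotheses to `ϖᵏ • L` and `ϖᵐ • L'`
  obtain ⟨Φ⟩ := nonempty_reductionEquiv ϖ hϖ L k
  obtain ⟨Ψ⟩ := nonempty_reductionEquiv ϖ hϖ L' m
  haveI : Finite (↥(ϖ ^ k • L) ⧸ (ϖ • (ϖ ^ k • L)).comap (ϖ ^ k • L).subtype) :=
    Finite.of_equiv _ Φ.toEquiv
  have hcard' : Nat.card (↥(ϖ ^ k • L) ⧸ (ϖ • (ϖ ^ k • L)).comap (ϖ ^ k • L).subtype) ≤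
      Nat.card (↥(ϖ ^ m • L') ⧸ (ϖ • (ϖ ^ m • L')).comap (ϖ ^ m • L').subtype) := by
    rw [← Nat.card_congr Φ.toEquiv, ← Nat.card_congr Ψ.toEquiv]
    exact hcard
  have htor' : ∃ n : ℕ, ϖ ^ n • (ϖ ^ k • L) ≤ ϖ ^ m • L' := by
    obtain ⟨n, hn⟩ := htor
    refine ⟨n + m, ?_⟩
    have hrw : ϖ ^ (n + m) • (ϖ ^ k • L) = ϖ ^ k • (ϖ ^ m • (ϖ ^ n • L)) := by
      simp only [smul_smul]
      congr 1
      ring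
    rw [hrw]
    exact (pointwise_smul_le_self (ϖ ^ k) _).trans (pointwise_smul_mono (ϖ ^ m) hn)
  -- (3) the normalised case
  exact eq_of_le_of_not_le_smul_of_socle ϖ hle hnot htor' hcard'
    (socle_transport Ψ hsocL') (socle_transport Φ hsocL) (mult_transport Ψ hmult)

end Homothety

end Literature.RepresentationTheory
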